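/-
Copyright: lit-balaban READER/TYPER seat r18 (gen 10; v1.1 gen 10).  Statement-level skeleton of a published paper; no proof claims beyond what
the kernel checks below.
-/
import Literature.MathematicalPhysics.QuantumFieldTheory.BalabanImbrieJaffe1984to88.BIJ85Sect72AllTori
import Literature.MathematicalPhysics.QuantumFieldTheory.BalabanImbrieJaffe1984to88.BIJ88Decay216Native

/-!
# `BalabanImbrieJaffe1984to88.BIJ88Decay216AllTori` — T. Bałaban, J. Imbrie, A. Jaffe, *Effective action and cluster properties of the
abelian Higgs model*, Commun. Math. Phys. **114** (1988) 257–315 [BalabanImbrieJaffe1988], Sect. 2 p. 261 [PDF 5]: **(2.16) OVER ALL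
TORI** — `|σ_k(p₁,p₂)| ≤ ce^{−c dist(p₁,p₂)}` with ONE pair of constants for EVERY torus `T_η` of the series (dimension `d`, block size `L`,
every volume `L^m`, every `ε = L^{−K}`) and EVERY scale `k ≤ m + K`, from «[6I] Proposition 1.2 by its tree name» read OVER THE ALL-TORI
INDEX — the faithful form of the printed *"uniformly in k"* (typing note G-C1-07 of `HOME/GAPS.md`, adopted for C2 §§1–4 in
`HOME/lit-balaban-r18/ROWS-C2.md` v1.76).

statement-level skeleton of published theorems with citation tags; proofs where landed; nothing here is a claim about the Yang–Mills mass gap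

PDF held: `paper:balaban1988-cmp114-bij-abelian-higgs-effective-action` (journal page = PDF page + 256), p. 261 [PDF 5]; [I] =
[BalabanImbrieJaffe1985] p. 325 [PDF 27] (7.2.2)/(7.2.3); [6I] = [Balaban1984PropagatorsI] Prop. 1.2 p. 35 [PDF 19].

CITATION HEADER (lean-in-tree rule).  Part of the lit-balaban TYPED SKELETON (HOME `run/shared/lean/pub/lit-balaban/`), READER/TYPER seat
r18 = the C2 §§1–4 fold owner (unit `lit-balaban-r18`, gen 10; TAKING line HOME/STATUS.md 2026-08-21T21:12:42Z).  Row served: **C2.Eq2.16**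
(`HOME/lit-balaban-r18/ROWS-C2.md`; head `proved p264361 + …`, r18's own `BIJ88Decay216Native` = (2.16) on the tori at every `d ≥ 2`) — here
its ALL-TORI re-quantification.  Decls used BY NAME (nothing restated): r18 gen 8's explicit `BIJ88Decay216Native.decay216_native_eta`
(constants from `(δ, M, δ_C, M_C, d)` only), p16 gen 7's `BIJ85Sect72AllTori.prop12Hyps_allTori_of_prop12Printed` / `gradH_le_allTori` /
`H_zero_apply` (p305613; the all-tori `∇H` member of (I.7.2.2) and the scale-0 kernel `H_0 = I`), p16's `BIJ85Ineq722AllTori.hyps_torus_deltaA_dim`,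
p09 gen 6's hypothesis-free all-tori (I.7.2.3) `BIJ85Ineq723TorusCE.ineq723_CE_lt`, p09's `rate722`/`const722`, p30's `sigmaTorus` (the
σ_k of record), p08's `pdist`.

THE PRINTED TEXT (p. 261 [PDF 5], verbatim).  *"The basic facts that we need about σ_k are its decay properties. These can be derived
from the second form in (2.15) using the regularity and decay of H_j, C^{(j)} for j < k … We obtain |σ_k(p₁, p₂)| ≦ ce^{−c dist(p₁,p₂)},
(2.16) … uniformly in k."*; [I] p. 325: *"there exists δ > 0 and for 0 ≤ α < 1 a constant M = M(α) < ∞ such that … (7.2.2). This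
inequality is a consequence of Proposition 1.2 and the representation (1.103) of [6I]."*; [6I] p. 35: *"Proposition 1.2. There exists a
positive constant δ₀ depending on d only, such that …"*, p. 33 *"independent of k, T_η, and depending on d only"*.

WHY A SEPARATE FILE.  r18's `BIJ88Decay216Native` (the natural home) is imported, through p08's `BIJ88Decay216Prop12` and
`BIJ85CurlyDkDecayTorus`, by p16's `BIJ85Sect72AllTori`; appending there would close an import cycle.

WHAT IS PROVED (kernel-checked; theorems only; 0 `sorry`; no new definition, no named fact; standard axioms):
* §1 the scale-`0` summand: `H_0 = I` (p16's `H_zero_apply`) has the (7.2.2)-SHAPE GRADIENT BOUND `‖λ ↦ (H_0(x+e_λ,μ; y,ν) −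
  H_0(x,μ; y,ν))‖ ≤ Me^{−δ|x − y|}` for every `δ ≥ 0`, `M ≥ e^{δ}` (`gradH_zero_norm_le`; the entries are `0, ±1` and vanish unless
  `|x − y|_∞ ≤ 1`) — scale `0` is outside [6I]'s `k ≥ 1` and outside the all-tori index, it enters (2.15)/(I.4.4.4) as the `j = 0` term.
* §2 **(2.16) OVER ALL TORI AT UNIFORM [6I]-CONSTANTS** (`decay216_allTori_of_prop12Hyps`): if p09's `Prop12Hyps C C_α δ₀` hold for the
  printed data `H_k = G_kQ_k^*(Q_kG_kQ_k^*)⁻¹`, `G_k = Δ_a⁻¹` on EVERY torus `P` (`P.d = d`, `P.L = L`) at EVERY scale `1 ≤ k ≤ m + K` with the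
  SAME `(C, C_α, δ₀)`, then with `r = rate722(d, a, C, δ₀)`, `c = const722(…)`, `M = max(c·e^{r/2}, e^{r})` and p09's all-tori `(M_C, δ_C)` of
  (I.7.2.3): for every such torus, every `k ≤ m + K` and all unit plaquettes with `pdist p₁ p₂ ≥ d(4r/a′ + 2)` (`a′ = min(r, δ_C)/2`),
  `|σ_k(p₁,p₂)| ≤ (4M²M_C·d²e^{a′/2}K(a′)²(d+1)!/a′^{d+1})·e^{−(a′/(2d))·pdist p₁ p₂}` — r18's `decay216_native_eta` verbatim, its inputs now
  chosen BEFORE the torus.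
* §3 **(2.16) OVER ALL TORI FROM [6I] PROP. 1.2 BY ITS TREE NAME** (`decay216_allTori_of_prop12Printed`): `B5.Prop12Printed` over the
  all-tori index `{(P, k) // P.d = d ∧ P.L = L ∧ 1 ≤ k ≤ m + K}` ⟹ `∃ R₀ c₀ δ′`, `δ′ > 0`, `c₀ ≥ 0`, such that FOR EVERY torus `P` (`P.d = d`,
  `P.L = L`), EVERY `k ≤ m + K`, all `p₁ p₂` with `pdist p₁ p₂ ≥ R₀`: `|σ_k(p₁, p₂)| ≤ c₀e^{−δ′·pdist p₁ p₂}` — (2.16) *"uniformly in k"* AND in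
  the volume, for p30's `σ_k` of record at the printed weights `(η_k^d, L^k)`.
* §4–§6 (v1.1, append-only) **(2.17), (2.18), (2.19) OVER ALL TORI** (`ineq217_allTori_of_prop12Printed`, `close218_allTori_of_prop12Printed`,
  `ineq219_allTori_of_prop12Printed`): the all-tori re-quantification of r18's `ineq217/close218/ineq219_native_of_prop12` — p08's explicit
  one-scale (2.17) `abs_ineq217_kernelBounds_torus` and `close_trunc_of_decay3`, p02's `ineq219_of_close`, [I] Thm. 7.1.1 at the physical
  weight (`ineq219_sigmaKernel_eta`), fed with §3 and the all-tori `∇H` member; (2.19): ONE radius `R₁` for all tori and scales, constant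
  `c711(d)`.
HONEST SCOPE.  Pure re-quantification (constants before the torus) of r18's per-torus theorem with p16's/p09's all-tori inputs; [6I]
Prop. 1.2 over all tori is the HYPOTHESIS `h12` (p37's `B5Prop12GHolds.prop12_famG_printed` proves it for r02's all-tori family; the encoding
bridge to p09's carriers is p19 g6's / p30 g9's programme in flight) — NOT proved here.  `U = 1`, real fields, tori of the series, `ℓ¹`
plaquette distance `pdist` and `ℓ^∞` site distances as in the cited files (their DIVERGENCE notes F2/F3 apply verbatim); threshold form
`R₀ ≤ pdist` as in all (2.16)/(2.17) files of the cell.  NOT summit progress.  Unit `lit-balaban-r18` (literature-prover-lit-balaban-r18-g10-0),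
2026-08-21.
-/

namespace Literature.MathematicalPhysics.QuantumFieldTheory.BalabanImbrieJaffe1984to88.BIJ88Decay216AllTori

open Literature.MathematicalPhysics.QuantumFieldTheory.Balaban1983to89 hiding Site Plaq
open scoped BigOperators RealInnerProductSpace
open Balaban1983to89.LatticeFieldCalculus
open BIJ85Ineq722Proof BIJ85Ineq722Proof.Rep103 BIJ85Ineq722ProofPart2 BIJ85Sect7Statements BIJ85Ineq722Torus BIJ85Ineq722DeltaA
open BIJ85Ineq722AllTori BIJ85Prop521Torus BIJ85Prop522Torus BIJ85Sigma421Torus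
open BIJ85Ineq723TorusCE (ineq723_CE_lt)
open BIJ85Eq721MinimizerKernel (torusKernelData_gradH)
open BIJ85Sect72AllTori (prop12Hyps_allTori_of_prop12Printed gradH_le_allTori H_zero_apply)
open BIJ88Ineq217NearPart (pdist)
open BIJ88Decay216Native (decay216_native_eta)
open BIJ88Ineq217Ineq722Torus (abs_ineq217_kernelBounds_torus)
open BIJ88Decay216Torus (sum_plaq_exp_neg_pdist_le)
open BIJ88Ineq217NearPart (loOf hiOf)
open Balaban1983to89.T4AxialGaugeSmallField (castSite boxPlaqs)
open BIJ88Sect2Statements (supNorm Ineq219 Close trunc)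
open BIJ88Close235Proof (supNorm_nonneg)
open BIJ88Close218Proof (ineq219_of_close)
open BIJ88Ineq219SigmaTorus (pdist_comm)
open BIJ88Ineq219TorusProp12 (ineq219_sigmaKernel_eta ineq219_mono close_trunc_of_decay3)
open BIJ85SigmaClosedCube (c711 c711_pos)

open Balaban1983to89 renaming Site → TSite, Plaq → TPlaq

noncomputable section

/-! ## §1  The scale-`0` summand: the gradient of `H_0 = I` -/

/-- `|x − (x + e_μ)|_∞ ≤ 1` (p08's private lemma, re-proved). [folklore] -/
private theorem supDist_shift_le {P : Params} {j : ℕ} (x : TSite P j) (μ : Fin P.d) : supDist x (x.shift μ) ≤ 1 := by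
  have h := supDist_runSite_le x μ 1
  have h2 : runSite x μ 1 = x.shift μ := by
    show Function.update x μ (x μ + ((1 : ℕ) : ZMod _)) = Function.update x μ (x μ + 1)
    rw [Nat.cast_one]
  rwa [h2] at h

/-- at scale `0` the block centre is the point itself: `ctr 0 y = y`. [cite: BalabanImbrieJaffe1985, (7.2.2) p.325] -/
private theorem ctr_zero {P : Params} (y : TSite P 0) : ctr 0 y = y := by
  funext m
  simp [ctr]

/-- at scale `0`, `dist(x, y) = |x − y|_∞`. [cite: BalabanImbrieJaffe1985, (7.2.2) p.325] -/
private theorem distEU_zero {P : Params} (x y : TSite P 0) : distEU P 0 x y = (supDist x y : ℝ) := by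
  rw [distEU, ctr_zero, pow_zero, div_one]

/-- **THE SCALE-`0` GRADIENT BOUND**: for the identity kernel `H_0` (p16's `H_zero_apply`), every `δ ≥ 0` and `M ≥ e^{δ}`,
`‖λ ↦ L^0·(H_0((x+e_λ, μ),(y, ν)) − H_0((x, μ),(y, ν)))‖ ≤ Me^{−δ·dist(x,y)}`: the entries are `0, ±1` and vanish unless `y ∈ {x, x + e_λ}`,
where `dist(x, y) ≤ 1`. (The `j = 0` term of (2.15)/(I.4.4.4) in the (7.2.2)-shape the (2.16) files consume.) [cite: BalabanImbrieJaffe1985, (7.2.2) p.325] -/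
theorem gradH_zero_norm_le {P : Params} (h0 : 0 ≤ P.m + P.K) {a : ℝ} (ha : 0 < a) {δ M : ℝ} (hδ : 0 ≤ δ)
    (hM : Real.exp δ ≤ M) (μ ν : Fin P.d) (x y : TSite P 0) :
    ‖fun lam : Fin P.d => (P.L : ℝ) ^ 0 *
        ((torusRep P 0 (deltaAData h0 a)).H (x.shift lam, μ) (y, ν) - (torusRep P 0 (deltaAData h0 a)).H (x, μ) (y, ν))‖ ≤
      M * Real.exp (-(δ * distEU P 0 x y)) := by
  have hM0 : 0 ≤ M := (Real.exp_pos δ).le.trans hM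
  refine (pi_norm_le_iff_of_nonneg (by positivity)).2 fun lam => ?_
  rw [pow_zero, one_mul, Real.norm_eq_abs, H_zero_apply h0 ha, H_zero_apply h0 ha]
  -- if `y ∉ {x, x + e_λ}` both entries vanish
  by_cases hfar : 1 < distEU P 0 x y
  · have hy1 : ¬ (⟨x.shift lam, μ⟩ : PBond P 0) = ⟨y, ν⟩ := by
      intro h
      have hy : y = x.shift lam := (congrArg PBond.src h).symm
      rw [hy, distEU_zero] at hfar
      have h1 : (supDist x (x.shift lam) : ℝ) ≤ 1 := by exact_mod_cast supDist_shift_le x lam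
      linarith
    have hy2 : ¬ (⟨x, μ⟩ : PBond P 0) = ⟨y, ν⟩ := by
      intro h
      have hy : y = x := (congrArg PBond.src h).symm
      rw [hy, distEU_zero, (B3TorusRadialSums.supDist_eq_zero_iff x x).2 rfl, Nat.cast_zero] at hfar
      linarith
    rw [if_neg hy1, if_neg hy2, sub_zero, abs_zero]
    positivity
  -- otherwise `dist ≤ 1`, the entry is at most `1 ≤ e^{δ}e^{−δ·dist} ≤ Me^{−δ·dist}`
  · have hdist : distEU P 0 x y ≤ 1 := not_lt.1 hfar
    have hval : |(if (⟨x.shift lam, μ⟩ : PBond P 0) = ⟨y, ν⟩ then (1 : ℝ) else 0) -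
        (if (⟨x, μ⟩ : PBond P 0) = ⟨y, ν⟩ then (1 : ℝ) else 0)| ≤ 1 := by
      split_ifs <;> norm_num
    refine hval.trans ?_
    have h1 : (1 : ℝ) ≤ Real.exp δ * Real.exp (-(δ * distEU P 0 x y)) := by
      rw [← Real.exp_add]
      exact Real.one_le_exp (by nlinarith)
    exact h1.trans (mul_le_mul_of_nonneg_right hM (Real.exp_pos _).le)

/-! ## §2  (2.16) over all tori at uniform [6I]-constants -/

/-- **(2.16) OVER ALL TORI AT UNIFORM [6I]-CONSTANTS, EXPLICIT**: p09's `Prop12Hyps C C_α δ₀` for the printed data on EVERY torus `P` with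
`P.d = d`, `P.L = L` at EVERY scale `1 ≤ k ≤ m + K` (the same `(C, C_α, δ₀)` — [6I] p. 33 *"independent of k, T_η"*), and p09's all-tori
(I.7.2.3) constants `(M_C, δ_C)`, give r18's explicit (2.16) bound `decay216_native_eta` with ALL ITS INPUTS CHOSEN BEFORE THE TORUS:
`r = rate722`, `c = const722`, `M = max(c·e^{r/2}, e^{r})` (the second entry for the scale-`0` summand, §1).
[cite: BalabanImbrieJaffe1988, (2.16) p.261] -/
theorem decay216_allTori_of_prop12Hyps {d L : ℕ} (hd : 2 ≤ d) {a C δ₀ : ℝ} {Cα : ℝ → ℝ} (ha : 0 < a)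
    (hall : ∀ (P : Params) (_ : P.d = d) (_ : P.L = L) (k : ℕ) (_ : 1 ≤ k) (hk : k ≤ P.m + P.K),
      (torusRep P k (deltaAData hk a)).Prop12Hyps C Cα δ₀)
    (hr : 0 < rate722 d C δ₀ (T4GaugeActionRate.gam0 d / (4 * d + a)) 1 1 1 (fun t : ℝ => (2 * (1 + (d : ℝ) / t)) ^ d))
    {MC δC : ℝ} (hMC : 0 ≤ MC) (hδC : 0 < δC)
    (hC : ∀ (P : Params), P.d = d → P.L = L → ∀ (k : ℕ), k ≤ P.m + P.K →
      ∀ (j : ℕ) (_ : DecidableEq (PBond P j)), j < k → ∀ b b' : PBond P j,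
        |⟪toEj P j (Pi.single b 1), CE P ((P.eta j) ^ P.d) ((P.L : ℝ) ^ j) j (toEj P j (Pi.single b' 1))⟫| ≤
          MC * Real.exp (-(δC * (supDist b.src b'.src : ℝ))))
    {P : Params} (hPd : P.d = d) (hPL : P.L = L) (hdP : 2 ≤ P.d) {k : ℕ} (hk : k ≤ P.m + P.K) (p₁ p₂ : TPlaq P k)
    (hfar : (d : ℝ) * (4 * rate722 d C δ₀ (T4GaugeActionRate.gam0 d / (4 * d + a)) 1 1 1 (fun t : ℝ => (2 * (1 + (d : ℝ) / t)) ^ d) /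
        (min (rate722 d C δ₀ (T4GaugeActionRate.gam0 d / (4 * d + a)) 1 1 1 (fun t : ℝ => (2 * (1 + (d : ℝ) / t)) ^ d)) δC / 2) + 2) ≤
      pdist p₁ p₂) :
    |sigmaTorus (P := P) hdP ((P.eta k) ^ P.d) ((P.L : ℝ) ^ k) k (toU P k (Pi.single p₂ 1)) p₁| ≤
      (4 * (max (const722 d C δ₀ (T4GaugeActionRate.gam0 d / (4 * d + a)) 1 1 1 (fun t : ℝ => (2 * (1 + (d : ℝ) / t)) ^ d) *
              Real.exp (rate722 d C δ₀ (T4GaugeActionRate.gam0 d / (4 * d + a)) 1 1 1 (fun t : ℝ => (2 * (1 + (d : ℝ) / t)) ^ d) * (1 / 2)))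
            (Real.exp (rate722 d C δ₀ (T4GaugeActionRate.gam0 d / (4 * d + a)) 1 1 1 (fun t : ℝ => (2 * (1 + (d : ℝ) / t)) ^ d)))) ^ 2 *
          MC * ((d : ℝ) ^ 2 * (Real.exp (min (rate722 d C δ₀ (T4GaugeActionRate.gam0 d / (4 * d + a)) 1 1 1
              (fun t : ℝ => (2 * (1 + (d : ℝ) / t)) ^ d)) δC / 2 / 2) *
            ((2 * (1 + d / (min (rate722 d C δ₀ (T4GaugeActionRate.gam0 d / (4 * d + a)) 1 1 1
              (fun t : ℝ => (2 * (1 + (d : ℝ) / t)) ^ d)) δC / 2))) ^ d) ^ 2)) *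
          (((d + 1).factorial : ℝ) / (min (rate722 d C δ₀ (T4GaugeActionRate.gam0 d / (4 * d + a)) 1 1 1
              (fun t : ℝ => (2 * (1 + (d : ℝ) / t)) ^ d)) δC / 2) ^ (d + 1))) *
        Real.exp (-(min (rate722 d C δ₀ (T4GaugeActionRate.gam0 d / (4 * d + a)) 1 1 1 (fun t : ℝ => (2 * (1 + (d : ℝ) / t)) ^ d))
            δC / 2 / 2 / d) * pdist p₁ p₂) := by
  subst hPd
  set r := rate722 P.d C δ₀ (T4GaugeActionRate.gam0 P.d / (4 * P.d + a)) 1 1 1 (fun t : ℝ => (2 * (1 + (P.d : ℝ) / t)) ^ P.d)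
    with hr_def
  set c := const722 P.d C δ₀ (T4GaugeActionRate.gam0 P.d / (4 * P.d + a)) 1 1 1 (fun t : ℝ => (2 * (1 + (P.d : ℝ) / t)) ^ P.d)
    with hc_def
  set M := max (c * Real.exp (r * (1 / 2))) (Real.exp r) with hM_def
  refine decay216_native_eta hdP hk ha hr hδC hMC (fun j hj hjk μ ν x y => ?_)
    (fun j hjk b b' => hC P rfl hPL k hk j inferInstance hjk b b') p₁ p₂ hfar
  -- the gradient member of (7.2.2) at scale `j`, constants before the torus
  rcases Nat.eq_zero_or_pos j with hj0 | hj1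
  · subst hj0
    exact gradH_zero_norm_le hj ha hr.le (le_max_right _ _) μ ν x y
  · have h := gradH_le_allTori ha (d := P.d) rfl hj (hall P rfl hPL j hj1 hj) PUnit (fun _ _ => 0) (fun _ _ _ _ => 0)
      (fun _ _ => 0) μ ν x y
    rw [torusKernelData_gradH hj a] at h
    exact h.trans (mul_le_mul_of_nonneg_right (le_max_left _ _) (Real.exp_pos _).le)

/-! ## §3  (2.16) over all tori from [6I] Prop. 1.2 by its tree name -/

/-- **(2.16) OVER ALL TORI FROM [6I] PROPOSITION 1.2 BY ITS TREE NAME** (the faithful form of *"uniformly in k"*, typing note G-C1-07):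
if `B5.Prop12Printed` holds over the ALL-TORI index of dimension `d ≥ 2` and block size `L` (constants *"depending on d only … independent
of k, T_η"*), then there are `R₀, c₀ ≥ 0, δ′ > 0` such that for EVERY torus `P` of the series with `P.d = d`, `P.L = L` (every volume, every
`ε = L^{−K}`), EVERY scale `k ≤ m + K` and all unit plaquettes `p₁, p₂` with `pdist p₁ p₂ ≥ R₀`:
`|σ_k(p₁, p₂)| ≤ c₀·e^{−δ′·pdist p₁ p₂}` for p30's `σ_k` of record at the printed weights. [cite: BalabanImbrieJaffe1988, (2.16) p.261] -/
theorem decay216_allTori_of_prop12Printed {d L : ℕ} (hd : 2 ≤ d) (hL : Odd L ∧ 1 < L) {a : ℝ} (ha : 0 < a)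
    (h12 : B5.Prop12Printed (fun i : {x : Params × ℕ // x.1.d = d ∧ x.1.L = L ∧ 1 ≤ x.2 ∧ x.2 ≤ x.1.m + x.1.K} =>
      settingOf (torusRep i.1.1 i.1.2 (deltaAData i.2.2.2.2 a)) i.1.2)) :
    ∃ R₀ c₀ δ' : ℝ, 0 < δ' ∧ 0 ≤ c₀ ∧ ∀ (P : Params) (_ : P.d = d) (_ : P.L = L) (hdP : 2 ≤ P.d) (k : ℕ) (_ : k ≤ P.m + P.K)
      (p₁ p₂ : TPlaq P k), R₀ ≤ pdist p₁ p₂ →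
        |sigmaTorus (P := P) hdP ((P.eta k) ^ P.d) ((P.L : ℝ) ^ k) k (toU P k (Pi.single p₂ 1)) p₁| ≤
          c₀ * Real.exp (-δ' * pdist p₁ p₂) := by
  obtain ⟨C, δ₀, Cα, hCpos, hδ₀, hall⟩ := prop12Hyps_allTori_of_prop12Printed h12
  obtain ⟨MC, δC, hMC, hδC, hC⟩ := ineq723_CE_lt d L hd
  -- positivity of the (7.2.2) rate: witnessed on the torus `⟨d, L, 0, 1⟩` at scale `1`
  set P₀ : Params := ⟨d, L, 0, 1, le_trans one_le_two hd, hL⟩ with hP₀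
  have hk₀ : 1 ≤ P₀.m + P₀.K := le_rfl
  have hH₀ := hyps_torus_deltaA_dim (P := P₀) (d := d) rfl hk₀ ha
  have h12₀ := hall P₀ rfl rfl 1 le_rfl hk₀
  set r := rate722 d C δ₀ (T4GaugeActionRate.gam0 d / (4 * d + a)) 1 1 1 (fun t : ℝ => (2 * (1 + (d : ℝ) / t)) ^ d) with hr_def
  set c := const722 d C δ₀ (T4GaugeActionRate.gam0 d / (4 * d + a)) 1 1 1 (fun t : ℝ => (2 * (1 + (d : ℝ) / t)) ^ d) with hc_def
  have hrpos : 0 < r := rate722_pos hH₀ h12₀ d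
  have hd0 : (0 : ℝ) < d := by exact_mod_cast lt_of_lt_of_le two_pos hd
  have ha' : 0 < min r δC / 2 := half_pos (lt_min hrpos hδC)
  refine ⟨(d : ℝ) * (4 * r / (min r δC / 2) + 2),
    4 * (max (c * Real.exp (r * (1 / 2))) (Real.exp r)) ^ 2 * MC *
        ((d : ℝ) ^ 2 * (Real.exp (min r δC / 2 / 2) * ((2 * (1 + d / (min r δC / 2))) ^ d) ^ 2)) *
      (((d + 1).factorial : ℝ) / (min r δC / 2) ^ (d + 1)),
    min r δC / 2 / 2 / d, by positivity, ?_, fun P hPd hPL hdP k hk p₁ p₂ hfar => ?_⟩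
  · have hMC0 : 0 ≤ MC := hMC.le
    positivity
  · have h := decay216_allTori_of_prop12Hyps hd ha hall hrpos hMC.le hδC hC hPd hPL hdP hk p₁ p₂ hfar
    rw [neg_mul] at h ⊢
    exact h

/-! ## §4 (v1.1)  (2.17) over all tori -/

/-- **(2.17) OVER ALL TORI FROM [6I] PROP. 1.2 BY ITS TREE NAME**: `B5.Prop12Printed` over the all-tori index ⟹ there are `R₀` and `C ≥ 0`
such that for EVERY torus `P` (`P.d = d`, `P.L = L`), EVERY scale `k ≤ m + K`, every box radius `R ≥ R₀` with `2R < |T^{(k)}|` per direction,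
every `p₁` (`p₁.src = castSite z₁`) and every `f` that is a curl `∂A` on the box of radius `R` about `p₁`: `|(σ_kf)(p₁)| ≤ C(1 + R)·‖f‖_∞` —
p08's explicit one-scale (2.17) `abs_ineq217_kernelBounds_torus` (p. 262: near part from (I.7.2.1)–(7.2.2), far part from (2.16)) fed with
the all-tori `∇H` member (p16; scale `0` by §1) and §3's all-tori (2.16). [cite: BalabanImbrieJaffe1988, (2.17) p.262] -/
theorem ineq217_allTori_of_prop12Printed {d L : ℕ} (hd : 2 ≤ d) (hL : Odd L ∧ 1 < L) {a : ℝ} (ha : 0 < a)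
    (h12 : B5.Prop12Printed (fun i : {x : Params × ℕ // x.1.d = d ∧ x.1.L = L ∧ 1 ≤ x.2 ∧ x.2 ≤ x.1.m + x.1.K} =>
      settingOf (torusRep i.1.1 i.1.2 (deltaAData i.2.2.2.2 a)) i.1.2)) :
    ∃ R₀ C : ℝ, 0 ≤ C ∧ ∀ (P : Params) (_ : P.d = d) (_ : P.L = L) (hdP : 2 ≤ P.d) (k : ℕ) (hk : k ≤ P.m + P.K) (R : ℕ),
      R₀ ≤ R → 2 * R < P.sitesPerDir k → ∀ (p₁ : TPlaq P k) (z₁ : Fin P.d → ℤ), p₁.src = castSite z₁ →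
      ∀ (f : TPlaq P k → ℝ) (A : VecField P k ℝ), (∀ p ∈ boxPlaqs (loOf z₁ R) (hiOf z₁ R), f p = curl 1 A p) →
        |sigmaTorus (P := P) hdP ((P.eta k) ^ P.d) ((P.L : ℝ) ^ k) k (toU P k f) p₁| ≤ C * (1 + R) * supNorm f := by
  obtain ⟨C, δ₀, Cα, hCpos, hδ₀, hall⟩ := prop12Hyps_allTori_of_prop12Printed h12
  obtain ⟨R₀, c₀, δ', hδ', hc₀, h216⟩ := decay216_allTori_of_prop12Printed hd hL ha h12
  -- positivity of the (7.2.2) rate, witnessed on `⟨d, L, 0, 1⟩`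
  set P₀ : Params := ⟨d, L, 0, 1, le_trans one_le_two hd, hL⟩ with hP₀
  have hk₀ : 1 ≤ P₀.m + P₀.K := le_rfl
  have hH₀ := hyps_torus_deltaA_dim (P := P₀) (d := d) rfl hk₀ ha
  have h12₀ := hall P₀ rfl rfl 1 le_rfl hk₀
  set r := rate722 d C δ₀ (T4GaugeActionRate.gam0 d / (4 * d + a)) 1 1 1 (fun t : ℝ => (2 * (1 + (d : ℝ) / t)) ^ d) with hr_def
  set c := const722 d C δ₀ (T4GaugeActionRate.gam0 d / (4 * d + a)) 1 1 1 (fun t : ℝ => (2 * (1 + (d : ℝ) / t)) ^ d) with hc_def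
  have hrpos : 0 < r := rate722_pos hH₀ h12₀ d
  set M := max (c * Real.exp (r * (1 / 2))) (Real.exp r) with hM_def
  have hM0 : 0 ≤ M := (Real.exp_pos r).le.trans (le_max_right _ _)
  set S : ℝ := (d : ℝ) ^ 2 * (2 * (1 + δ'⁻¹)) ^ d with hS
  have hS0 : 0 ≤ S := by positivity
  set C₁ : ℝ := 2 * M * Real.exp (r / 2) * ((d : ℝ) * (2 * (1 + (r / d)⁻¹)) ^ d) with hC₁
  have hd0 : (0 : ℝ) < d := by exact_mod_cast lt_of_lt_of_le two_pos hd
  have hC₁0 : 0 ≤ C₁ := by positivity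
  have hd1 : (0 : ℝ) ≤ ((d - 1 : ℕ) : ℝ) := Nat.cast_nonneg _
  refine ⟨R₀, 2 * C₁ * ((d - 1 : ℕ) : ℝ) + c₀ * S * (1 + 8 * ((d - 1 : ℕ) : ℝ)), by positivity, ?_⟩
  intro P hPd hPL hdP k hk R hR0 hR p₁ z₁ h₁ f A hf
  subst hPd
  -- the gradient member of (7.2.2) at scale `k`, constants before the torus
  have hB : ∀ (μ ν : Fin P.d) (x : TSite P 0) (y : TSite P k),
      (torusKernelData P k (deltaAData hk a) PUnit (fun _ _ => 0) (fun _ _ _ _ => 0) (fun _ _ => 0)).gradH μ ν x y ≤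
        M * Real.exp (-(r * distEU P k x y)) := by
    intro μ ν x y
    rcases Nat.eq_zero_or_pos k with hk0 | hk1
    · subst hk0
      rw [torusKernelData_gradH hk a]
      exact gradH_zero_norm_le hk ha hrpos.le (le_max_right _ _) μ ν x y
    · exact (gradH_le_allTori ha (d := P.d) rfl hk (hall P rfl hPL k hk1 hk) PUnit (fun _ _ => 0) (fun _ _ _ _ => 0)
        (fun _ _ => 0) μ ν x y).trans (mul_le_mul_of_nonneg_right (le_max_left _ _) (Real.exp_pos _).le)
  have main := abs_ineq217_kernelBounds_torus hdP hk ha hrpos hM0 hc₀ hB hR h₁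
    (fun p₂ hp => h216 P rfl hPL hdP k hk p₁ p₂ (hR0.trans hp)) (sum_plaq_exp_neg_pdist_le hδ' p₁) hf
  refine main.trans (mul_le_mul_of_nonneg_right ?_ (supNorm_nonneg f))
  have hR' : (0 : ℝ) ≤ R := Nat.cast_nonneg _
  push_cast
  nlinarith [mul_nonneg hC₁0 hd1, mul_nonneg (mul_nonneg hc₀ hS0) hd1, mul_nonneg hC₁0 (mul_nonneg hd1 hR'),
    mul_nonneg (mul_nonneg hc₀ hS0) hR']

/-! ## §5 (v1.1)  (2.18) over all tori -/

/-- **(2.18) OVER ALL TORI FROM [6I] PROP. 1.2 BY ITS TREE NAME**: `∃ R₀, c₀ ≥ 0, δ′ > 0` such that for EVERY torus `P` (`P.d = d`, `P.L = L`),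
EVERY `k ≤ m + K` and every radius `R ≥ R₀`: `Close pdist σ_{k,loc} σ_k (c₀e^{−(δ′/2)R}) (δ′/2)` for the kernel of p30's `σ_k` at the printed
weights and its (2.14)-truncation at radius `R` (§3 into p08's `close_trunc_of_decay3`). [cite: BalabanImbrieJaffe1988, (2.18) p.262] -/
theorem close218_allTori_of_prop12Printed {d L : ℕ} (hd : 2 ≤ d) (hL : Odd L ∧ 1 < L) {a : ℝ} (ha : 0 < a)
    (h12 : B5.Prop12Printed (fun i : {x : Params × ℕ // x.1.d = d ∧ x.1.L = L ∧ 1 ≤ x.2 ∧ x.2 ≤ x.1.m + x.1.K} =>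
      settingOf (torusRep i.1.1 i.1.2 (deltaAData i.2.2.2.2 a)) i.1.2)) :
    ∃ R₀ c₀ δ' : ℝ, 0 < δ' ∧ 0 ≤ c₀ ∧ ∀ (P : Params) (_ : P.d = d) (_ : P.L = L) (hdP : 2 ≤ P.d) (k : ℕ) (_ : k ≤ P.m + P.K)
      (R : ℝ), R₀ ≤ R →
        Close pdist (trunc pdist R fun p q => sigmaTorus (P := P) hdP ((P.eta k) ^ P.d) ((P.L : ℝ) ^ k) k (toU P k (Pi.single q 1)) p)
          (fun p q => sigmaTorus (P := P) hdP ((P.eta k) ^ P.d) ((P.L : ℝ) ^ k) k (toU P k (Pi.single q 1)) p)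
          (c₀ * Real.exp (-(δ' / 2) * R)) (δ' / 2) := by
  obtain ⟨R₀, c₀, δ', hδ', hc₀, h216⟩ := decay216_allTori_of_prop12Printed hd hL ha h12
  exact ⟨R₀, c₀, δ', hδ', hc₀, fun P hPd hPL hdP k hk R hR =>
    close_trunc_of_decay3 hc₀ hδ'.le hR (h216 P hPd hPL hdP k hk)⟩

/-! ## §6 (v1.1)  (2.19) over all tori -/

/-- `c₀Se^{−(δ′/2)R} ≤ γ` for `R ≥ max(1, 2c₀S/(δ′γ))` (`e^{−y} ≤ 1/y`; p08's private lemma, re-proved). [folklore] -/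
private theorem small_of_large' {c₀ S δ' γ R : ℝ} (hc₀ : 0 ≤ c₀) (hS : 0 ≤ S) (hδ' : 0 < δ') (hγ : 0 < γ) (hR1 : 1 ≤ R)
    (hR : 2 * (c₀ * S) / (δ' * γ) ≤ R) : c₀ * Real.exp (-(δ' / 2) * R) * S ≤ γ := by
  have hy : 0 < δ' / 2 * R := by positivity
  have hexp : Real.exp (-(δ' / 2) * R) ≤ 1 / (δ' / 2 * R) := by
    rw [neg_mul, Real.exp_neg, one_div]
    exact inv_anti₀ hy ((by linarith : δ' / 2 * R ≤ δ' / 2 * R + 1).trans (Real.add_one_le_exp _))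
  have h1 : c₀ * Real.exp (-(δ' / 2) * R) * S ≤ c₀ * (1 / (δ' / 2 * R)) * S :=
    mul_le_mul_of_nonneg_right (mul_le_mul_of_nonneg_left hexp hc₀) hS
  refine h1.trans ?_
  rw [div_le_iff₀ (by positivity)] at hR
  rw [mul_one_div, div_mul_eq_mul_div, div_le_iff₀ hy]
  nlinarith

/-- **(2.19) OVER ALL TORI FROM [6I] PROP. 1.2 BY ITS TREE NAME — «σ_{k,loc} ≧ c > 0», ONE RADIUS FOR ALL TORI AND SCALES**: `∃ R₁` such
that for EVERY torus `P` (`P.d = d`, `P.L = L`), EVERY `k ≤ m + K` and every truncation radius `R ≥ R₁`, r18's typed `Ineq219 σ_{k,loc} (c711 d)`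
holds for the (2.14)-truncation of the kernel of p30's `σ_k` at the printed weights — [I] Thm. 7.1.1 (p08's `ineq219_sigmaKernel_eta`, constant
`2c711(d)`), §5's closeness, p02's `ineq219_of_close` with the plaquette row sums, and `c₀e^{−(δ′/2)R}·d²(2(1 + (δ′/2)⁻¹))^d ≤ c711(d)` for
`R ≥ R₁`. [cite: BalabanImbrieJaffe1988, (2.19) p.262] -/
theorem ineq219_allTori_of_prop12Printed {d L : ℕ} (hd : 2 ≤ d) (hL : Odd L ∧ 1 < L) {a : ℝ} (ha : 0 < a)
    (h12 : B5.Prop12Printed (fun i : {x : Params × ℕ // x.1.d = d ∧ x.1.L = L ∧ 1 ≤ x.2 ∧ x.2 ≤ x.1.m + x.1.K} =>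
      settingOf (torusRep i.1.1 i.1.2 (deltaAData i.2.2.2.2 a)) i.1.2)) :
    ∃ R₁ : ℝ, ∀ (P : Params) (_ : P.d = d) (_ : P.L = L) (hdP : 2 ≤ P.d) (k : ℕ) (_ : k ≤ P.m + P.K) (R : ℝ), R₁ ≤ R →
        Ineq219 (trunc pdist R fun p q => sigmaTorus (P := P) hdP ((P.eta k) ^ P.d) ((P.L : ℝ) ^ k) k (toU P k (Pi.single q 1)) p)
          (c711 d) := by
  obtain ⟨R₀, c₀, δ', hδ', hc₀, h218⟩ := close218_allTori_of_prop12Printed hd hL ha h12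
  have hd0 : 0 < d := lt_of_lt_of_le two_pos hd
  have hγ : 0 < c711 d := c711_pos hd0
  set S : ℝ := (d : ℝ) ^ 2 * (2 * (1 + (δ' / 2)⁻¹)) ^ d with hS
  have hS0 : 0 ≤ S := by positivity
  refine ⟨max R₀ (max 1 (2 * (c₀ * S) / (δ' * c711 d))), fun P hPd hPL hdP k hk R hR => ?_⟩
  subst hPd
  have hR0 : R₀ ≤ R := (le_max_left _ _).trans hR
  have hR1 : 1 ≤ R := ((le_max_left _ _).trans (le_max_right _ _)).trans hR
  have hR2 : 2 * (c₀ * S) / (δ' * c711 P.d) ≤ R := ((le_max_right _ _).trans (le_max_right _ _)).trans hR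
  have hsmall' : c₀ * Real.exp (-(δ' / 2) * R) * S ≤ c711 P.d := small_of_large' hc₀ hS0 hδ' hγ hR1 hR2
  have hLk : ((P.L : ℝ) ^ k) ≠ 0 := pow_ne_zero _ P.cast_L_pos.ne'
  have h := ineq219_of_close (ineq219_sigmaKernel_eta hdP hk hLk) (h218 P rfl hPL hdP k hk R hR0) pdist_comm
    (fun p₁ => sum_plaq_exp_neg_pdist_le (half_pos hδ') p₁) (by positivity) (by linarith)
  exact ineq219_mono h hγ (by linarith)

end

end Literature.MathematicalPhysics.QuantumFieldTheory.BalabanImbrieJaffe1984to88.BIJ88Decay216AllTori
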